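/-
Copyright: the b2b-balaban T⁴-continuum CRUX team, row NE7b OWNER lineage `t4-ne7b-p1` (gen 131). Project licence.
-/
import Mathlib.Combinatorics.SimpleGraph.Metric
import Mathlib.Analysis.SpecificLimits.Basic
import Mathlib.Analysis.SpecialFunctions.Exp

/-!
# THE GEOMETRIC POTENTIAL OF THE CELL GRAPH AND THE LEVEL-SET SUMMATION: for a relation `R` on the cells with `≤ Δ` neighbours
# (`R x y → y ∈ nbr x`, `#nbr x ≤ Δ`), the graph distance `d = dist_{R}(p₀, ·)` of the simple graph generated by `R` is a POTENTIAL in the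
# sense of (325)∕(326)∕(332c)∕(333) (`d p₀ = 0`, `d q ≤ d p + 1` across every edge), its level sets inside the component of `p₀` have at most
# `Δⁿ` cells (spheres sit inside the `n`-th iterated neighbourhood of `{p₀}`), and therefore any cell function bounded by a profile of the
# distance, `f q ≤ g(d q)` with `g ≥ 0`, has `Σ_{q∈S} f q ≤ Σ' n, Δⁿ·g n` for EVERY finite set `S` of cells reachable from `p₀` — uniformly in
# `#S`; with `g n = A·e^{−cn}·e^{η′n}` and `Δe^{η′−c} < 1` the sum is `A∕(1 − Δe^{η′−c})` (row NE7b, node U5c; Mathlib only; [folklore])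

Cell `pub-balaban`, sub-cell `t4`, spine estimate NE7b (`T4WeightBudget.RelWeightBound`; the cell's OWN estimate — NOT PRINTED in
[Bałaban 1983–89], NOT PROVED).  Crux-route work under `Spine/NE7b/` by the row OWNER (`t4-ne7b-p1` gen 131, file (340)) under FREEZE
(0)'s crux-prover clause, on § [NE7bP1-G130-HANDOFF] NEXT (3)(c) («a GEOMETRIC potential `d` for the block metric … and the exponentially
weighted ROW SUM … needs `#{cells at distance n} ≤ Δ(Δ−1)^{n−1}`»); NOTHING of Bałaban's is named as a Lean object, valued or asserted; no
`T4Continuum/Support` leaf typed; no `def`, no notation (the potential is Mathlib's `(SimpleGraph.fromRel R).dist p₀`, the iterated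
neighbourhood is `(fun T ↦ T.biUnion nbr)^[n] {p₀}`); zero `sorry`.  Imports: Mathlib only (`SimpleGraph.dist`, `Adj.diff_dist_adj`,
`Reachable.exists_walk_length_eq_dist`, `Walk.take`, `tsum_geometric_of_lt_one`).

WHAT IS PROVED ([folklore]; `G = SimpleGraph.fromRel R`):
* §1 THE POTENTIAL: `dist_self_zero`, **`dist_le_dist_add_one_of_rel`** (`R x y → G.dist p₀ y ≤ G.dist p₀ x + 1` — the hypothesis `hd` of
  (325) `cluster_size_ge_of_touches`, (326), (332c), (333)), `reachable_of_rel` (reachability propagates across `R`);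
* §2 SPHERES: `mem_iterate_nbr_of_dist_eq` (a cell at distance `n` reachable from `p₀` lies in the `n`-th iterated neighbourhood of `{p₀}`),
  `card_iterate_nbr_le` (`#((·).biUnion nbr)^[n]{p₀} ≤ Δⁿ`), **`card_level_le`** (`#{q ∈ S : G.dist p₀ q = n} ≤ Δⁿ` for reachable `S`);
* §3 THE LEVEL-SET SUMMATION: **`sum_le_tsum_levels`** (`f ≤ g ∘ d` on `S`, `g ≥ 0`, `Σ Δⁿg n` summable ⟹ `Σ_{q∈S} f q ≤ Σ' n, Δⁿ·g n`),
  `tsum_levels_exp` (`Σ' n, Δⁿ·(A·e^{−cn}·e^{η′n}) = A∕(1 − Δe^{η′−c})` and summability, for `Δe^{η′−c} < 1`), **`weighted_sum_le_of_decay`**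
  (`|a q| ≤ A·e^{−c·d q}` on `S` ⟹ `Σ_{q∈S}|a q|·e^{η′·d q} ≤ A∕(1 − Δe^{η′−c})` — the volume-uniform exponentially weighted row sum);
* §4 toy.

HONEST (what this is NOT).  Combinatorics of a bounded-degree graph; the road application (the next Hessian's weighted row sums from (333),
the near-diagonal entries from (322)) is the successor's; reachability from `p₀` is a hypothesis on `S` (on the torus the block graph is
connected); scalar skeleton ((A3), NC-NE7b-α UNRULED); nothing of Bałaban's asserted.  BY-NAME EFFECT ON THE WALL: NONE.  NE7b NOT PRINTED ∕
NOT PROVED; spine PROVED 0∕9; rung (B)+1 — the programme's measures remain FINITE-torus statements; NOT the mass gap, NOT Clay.  HONEST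
DEPENDENCY: continuum YM on T⁴ ⇐ BetaPertH ∧ nine spine estimates (0∕9 proved); BetaPertH ⇐ (D1) ∧ (D4) ∧ CAP+tail; G-an2-4 gates asym,
D1 and NE2∕3∕4.
-/

set_option autoImplicit false

noncomputable section

namespace Summit.QuantumFields.BalabanUV.T4Continuum.NE7b.SupCellGraphDistance

open Finset Real

variable {V : Type*} [DecidableEq V] {R : V → V → Prop}

/-! ## §1. The potential: graph distance from a marked cell -/

omit [DecidableEq V] in
/-- `d p₀ = 0`. [folklore] -/
theorem dist_self_zero (p₀ : V) : (SimpleGraph.fromRel R).dist p₀ p₀ = 0 := SimpleGraph.dist_self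

omit [DecidableEq V] in
/-- **The graph distance is a potential**: `R x y ⟹ d y ≤ d x + 1` (`d = dist(p₀, ·)` in the simple graph generated by `R`; no symmetry or
connectedness needed — Mathlib's `Adj.diff_dist_adj`). [folklore] -/
theorem dist_le_dist_add_one_of_rel (p₀ : V) {x y : V} (hxy : R x y) :
    (SimpleGraph.fromRel R).dist p₀ y ≤ (SimpleGraph.fromRel R).dist p₀ x + 1 := by
  by_cases hne : x = y
  · subst hne; omega
  · have hadj : (SimpleGraph.fromRel R).Adj x y := (SimpleGraph.fromRel_adj R x y).2 ⟨hne, Or.inl hxy⟩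
    rcases hadj.diff_dist_adj (u := p₀) with h | h | h <;> omega

omit [DecidableEq V] in
/-- Reachability from `p₀` propagates across `R`. [folklore] -/
theorem reachable_of_rel (p₀ : V) {x y : V} (hxy : R x y) (hx : (SimpleGraph.fromRel R).Reachable p₀ x) :
    (SimpleGraph.fromRel R).Reachable p₀ y := by
  by_cases hne : x = y
  · exact hne ▸ hx
  · exact hx.trans ((SimpleGraph.fromRel_adj R x y).2 ⟨hne, Or.inl hxy⟩).reachable

/-! ## §2. Spheres sit inside iterated neighbourhoods -/

/-- **A cell at distance `n` reachable from `p₀` lies in the `n`-th iterated neighbourhood of `{p₀}`** (`R` symmetric, `R x y → y ∈ nbr x`):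
the penultimate cell of a shortest walk is at distance `n − 1`. [folklore] -/
theorem mem_iterate_nbr_of_dist_eq (hsymm : ∀ x y, R x y → R y x) {nbr : V → Finset V} (hnbr : ∀ x y, R x y → y ∈ nbr x) (p₀ : V) :
    ∀ n : ℕ, ∀ q : V, (SimpleGraph.fromRel R).Reachable p₀ q → (SimpleGraph.fromRel R).dist p₀ q = n →
      q ∈ (fun T : Finset V => T.biUnion nbr)^[n] {p₀} := by
  intro n
  induction n with
  | zero =>
      intro q hr hd
      rw [Function.iterate_zero, id_eq, mem_singleton]
      exact ((hr.dist_eq_zero_iff).1 hd).symm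
  | succ n ih =>
      intro q hr hd
      obtain ⟨w, hw⟩ := hr.exists_walk_length_eq_dist
      rw [hd] at hw
      -- the penultimate cell
      set q' := w.getVert n with hq'
      have hadj : (SimpleGraph.fromRel R).Adj q' q := by
        have h := w.adj_getVert_succ (i := n) (by omega)
        rw [← hw, SimpleGraph.Walk.getVert_length] at h
        exact h
      have hle : (SimpleGraph.fromRel R).dist p₀ q' ≤ n := by
        have h := SimpleGraph.dist_le (w.take n)
        rw [SimpleGraph.Walk.take_length, hw] at h
        exact h.trans (min_le_left _ _)
      have hge : n ≤ (SimpleGraph.fromRel R).dist p₀ q' := by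
        rcases hadj.diff_dist_adj (u := p₀) with h | h | h <;> omega
      have hr' : (SimpleGraph.fromRel R).Reachable p₀ q' := ⟨w.take n⟩
      have hmem := ih q' hr' (le_antisymm hle hge)
      rw [Function.iterate_succ_apply', mem_biUnion]
      refine ⟨q', hmem, ?_⟩
      rcases ((SimpleGraph.fromRel_adj R q' q).1 hadj).2 with h | h
      · exact hnbr _ _ h
      · exact hnbr _ _ (hsymm _ _ h)

/-- **The iterated neighbourhoods grow at most like `Δⁿ`**: `#nbr x ≤ Δ` ⟹ `#((·).biUnion nbr)^[n]{p₀} ≤ Δⁿ`. [folklore] -/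
theorem card_iterate_nbr_le {nbr : V → Finset V} {Δ : ℕ} (hΔ : ∀ x, (nbr x).card ≤ Δ) (p₀ : V) :
    ∀ n : ℕ, ((fun T : Finset V => T.biUnion nbr)^[n] {p₀}).card ≤ Δ ^ n := by
  intro n
  induction n with
  | zero => simp
  | succ n ih =>
      rw [Function.iterate_succ_apply', pow_succ]
      calc (((fun T : Finset V => T.biUnion nbr)^[n] {p₀}).biUnion nbr).card
          ≤ ∑ x ∈ (fun T : Finset V => T.biUnion nbr)^[n] {p₀}, (nbr x).card := card_biUnion_le
        _ ≤ ∑ _x ∈ (fun T : Finset V => T.biUnion nbr)^[n] {p₀}, Δ := sum_le_sum fun x _ => hΔ x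
        _ = ((fun T : Finset V => T.biUnion nbr)^[n] {p₀}).card * Δ := by rw [sum_const, smul_eq_mul]
        _ ≤ Δ ^ n * Δ := Nat.mul_le_mul_right Δ ih

/-- **THE LEVEL SETS OF THE POTENTIAL HAVE AT MOST `Δⁿ` CELLS**: for every finite set `S` of cells reachable from `p₀`,
`#{q ∈ S : dist(p₀,q) = n} ≤ Δⁿ` — uniformly in `#S`. [folklore] -/
theorem card_level_le (hsymm : ∀ x y, R x y → R y x) {nbr : V → Finset V} {Δ : ℕ} (hΔ : ∀ x, (nbr x).card ≤ Δ)
    (hnbr : ∀ x y, R x y → y ∈ nbr x) (p₀ : V) (S : Finset V) (hS : ∀ q ∈ S, (SimpleGraph.fromRel R).Reachable p₀ q) (n : ℕ) :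
    (S.filter fun q => (SimpleGraph.fromRel R).dist p₀ q = n).card ≤ Δ ^ n := by
  refine le_trans (card_le_card fun q hq => ?_) (card_iterate_nbr_le hΔ p₀ n)
  rw [mem_filter] at hq
  exact mem_iterate_nbr_of_dist_eq hsymm hnbr p₀ n q (hS q hq.1) hq.2

/-! ## §3. The level-set summation -/

/-- **THE LEVEL-SET SUMMATION**: `0 ≤ f q ≤ g(dist(p₀,q))` on a reachable finite `S`, `g ≥ 0`, `Σ Δⁿ·g n` summable ⟹
`Σ_{q∈S} f q ≤ Σ' n, Δⁿ·g n` — uniformly in `#S`. [folklore] -/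
theorem sum_le_tsum_levels (hsymm : ∀ x y, R x y → R y x) {nbr : V → Finset V} {Δ : ℕ} (hΔ : ∀ x, (nbr x).card ≤ Δ)
    (hnbr : ∀ x y, R x y → y ∈ nbr x) (p₀ : V) (S : Finset V) (hS : ∀ q ∈ S, (SimpleGraph.fromRel R).Reachable p₀ q)
    {f : V → ℝ} {g : ℕ → ℝ} (hg : ∀ n, 0 ≤ g n) (hfg : ∀ q ∈ S, f q ≤ g ((SimpleGraph.fromRel R).dist p₀ q))
    (hsum : Summable fun n => (Δ : ℝ) ^ n * g n) :
    ∑ q ∈ S, f q ≤ ∑' n, (Δ : ℝ) ^ n * g n := by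
  classical
  -- group by level up to the largest distance on `S`
  set N := S.sup fun q => (SimpleGraph.fromRel R).dist p₀ q with hN
  have hlev : ∀ q ∈ S, (SimpleGraph.fromRel R).dist p₀ q ∈ range (N + 1) := fun q hq =>
    mem_range.2 (Nat.lt_succ_of_le (le_sup (f := fun q => (SimpleGraph.fromRel R).dist p₀ q) hq))
  calc ∑ q ∈ S, f q ≤ ∑ q ∈ S, g ((SimpleGraph.fromRel R).dist p₀ q) := sum_le_sum hfg
    _ = ∑ n ∈ range (N + 1), ∑ q ∈ S.filter (fun q => (SimpleGraph.fromRel R).dist p₀ q = n), g n := by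
        rw [← sum_fiberwise_of_maps_to (g := fun q => (SimpleGraph.fromRel R).dist p₀ q) hlev]
        refine sum_congr rfl fun n _ => sum_congr rfl fun q hq => ?_
        rw [(mem_filter.1 hq).2]
    _ = ∑ n ∈ range (N + 1), ((S.filter (fun q => (SimpleGraph.fromRel R).dist p₀ q = n)).card : ℝ) * g n := by
        refine sum_congr rfl fun n _ => ?_
        rw [sum_const, nsmul_eq_mul]
    _ ≤ ∑ n ∈ range (N + 1), (Δ : ℝ) ^ n * g n := by
        refine sum_le_sum fun n _ => mul_le_mul_of_nonneg_right ?_ (hg n)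
        exact_mod_cast card_level_le hsymm hΔ hnbr p₀ S hS n
    _ ≤ ∑' n, (Δ : ℝ) ^ n * g n :=
        hsum.sum_le_tsum (range (N + 1)) fun n _ => mul_nonneg (pow_nonneg (Nat.cast_nonneg _) _) (hg n)

/-- The exponential profile: `0 ≤ Δe^{η′−c} < 1` ⟹ `n ↦ Δⁿ·(A·e^{−cn}·e^{η′n})` is summable with sum `A∕(1 − Δe^{η′−c})`. [folklore] -/
theorem tsum_levels_exp {Δ : ℕ} {A c η' : ℝ} (hq : (Δ : ℝ) * exp (η' - c) < 1) :
    Summable (fun n : ℕ => (Δ : ℝ) ^ n * (A * exp (-(c * n)) * exp (η' * n))) ∧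
      ∑' n : ℕ, (Δ : ℝ) ^ n * (A * exp (-(c * n)) * exp (η' * n)) = A / (1 - (Δ : ℝ) * exp (η' - c)) := by
  have hq0 : 0 ≤ (Δ : ℝ) * exp (η' - c) := by positivity
  have e : ∀ n : ℕ, (Δ : ℝ) ^ n * (A * exp (-(c * n)) * exp (η' * n)) = A * ((Δ : ℝ) * exp (η' - c)) ^ n := fun n => by
    rw [mul_pow, ← Real.exp_nat_mul, mul_assoc A, ← Real.exp_add]
    have : -(c * n) + η' * n = (n : ℝ) * (η' - c) := by ring
    rw [this]
    ring
  simp_rw [e]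
  refine ⟨(summable_geometric_of_lt_one hq0 hq).mul_left A, ?_⟩
  rw [tsum_mul_left, tsum_geometric_of_lt_one hq0 hq, div_eq_mul_inv]

/-- **THE VOLUME-UNIFORM EXPONENTIALLY WEIGHTED ROW SUM**: `R` symmetric with `≤ Δ` neighbours, `S` finite and reachable from `p₀`,
`|a q| ≤ A·e^{−c·dist(p₀,q)}` on `S` (`A ≥ 0`), `Δe^{η′−c} < 1` ⟹ `Σ_{q∈S} |a q|·e^{η′·dist(p₀,q)} ≤ A∕(1 − Δe^{η′−c})`. [folklore] -/
theorem weighted_sum_le_of_decay (hsymm : ∀ x y, R x y → R y x) {nbr : V → Finset V} {Δ : ℕ} (hΔ : ∀ x, (nbr x).card ≤ Δ)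
    (hnbr : ∀ x y, R x y → y ∈ nbr x) (p₀ : V) (S : Finset V) (hS : ∀ q ∈ S, (SimpleGraph.fromRel R).Reachable p₀ q)
    {a : V → ℝ} {A c η' : ℝ} (hA : 0 ≤ A) (ha : ∀ q ∈ S, |a q| ≤ A * exp (-(c * (SimpleGraph.fromRel R).dist p₀ q)))
    (hq : (Δ : ℝ) * exp (η' - c) < 1) :
    ∑ q ∈ S, |a q| * exp (η' * (SimpleGraph.fromRel R).dist p₀ q) ≤ A / (1 - (Δ : ℝ) * exp (η' - c)) := by
  obtain ⟨hsum, htsum⟩ := tsum_levels_exp (A := A) hq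
  rw [← htsum]
  refine sum_le_tsum_levels hsymm hΔ hnbr p₀ S hS (f := fun q => |a q| * exp (η' * (SimpleGraph.fromRel R).dist p₀ q))
    (g := fun n => A * exp (-(c * n)) * exp (η' * n)) (fun n => by positivity) (fun q hq' => ?_) hsum
  exact mul_le_mul_of_nonneg_right (ha q hq') (exp_pos _).le

/-! ## §4. Toy -/

/-- Toy (§1): on any relation the marked cell has potential `0`. -/
example (p₀ : Fin 3) : (SimpleGraph.fromRel (fun a b : Fin 3 => a.val + 1 = b.val)).dist p₀ p₀ = 0 := dist_self_zero p₀

end Summit.QuantumFields.BalabanUV.T4Continuum.NE7b.SupCellGraphDistance
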